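import Summits.NavierStokesRegularity.FluidComputer.RowSegmentSound
import HarnessLib

/-!
# The k53d chain: a uniform forcing budget (layer R, perturbed class U;
# `pub-fluidc-bp3/R1-DESIGN.md` §11.9)

HONEST FRAMING (cell `pub-fluidc`, blueprint seat bp3, gen 22): low prior, high value-of-information
experiment on Tao's machine paradigm; NOT a claim that NS blows up.

WHAT. The UNIFORM FORCING CLASS `U`: `|δF(σ)ₐ| ≤ δU a` with `δU = 2⁻¹⁹` on the first gate's block
(`a₁ b₁ c₁ d₁`) and `2⁻²⁹` on `a₂ b₂ c₂ d₂ e₂` (`δUQ`), and ONE rational fact by `native_decide`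
(`--computational` like the run files): `δU` is below EVERY row's certified disturbance allowance
`DELₖ/2^P` of the chain of record (`force_budgetQ`; the minima over the 1066 rows are `3.58e-6`
and `1.99e-9`). Consumed by `RowCircuitForced.lean`: every global solution of the FORCED circuit
`ẏ = F(y) + δF(σ)` with `δF ∈ U` runs the certified itinerary (the tube test `htube` and the two
switch-window tests of `RowChain.enclosure` hold uniformly).
[cite: Tao2016AveragedNS, §5.5 Thm 5.3 (5.5)]
-/

namespace Summit.NavierStokesRegularity.FluidComputer

open Literature.Analysis.FluidPDE.FluidComputer

namespace RowChain

open RowCheck RowCheck.RowData RowRun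

/-- The uniform forcing envelope of class `U`: `2⁻¹⁹` on modes `0–3`, `2⁻²⁹` on modes `4–8`.
[folklore] -/
def δUQ : Fin 9 → ℚ := ![1 / 524288, 1 / 524288, 1 / 524288, 1 / 524288, 1 / 536870912,
  1 / 536870912, 1 / 536870912, 1 / 536870912, 1 / 536870912]

/-- **Uniform forcing budget of the k53d chain**: `δU ≤ DELₖ/2^P` on every row. [folklore] -/
theorem force_budgetQ : ∀ k < 1066, ∀ a, δUQ a ≤ ((row k).DEL a : ℚ) / 2 ^ (row k).P := by
  native_decide

end RowChain

end Summit.NavierStokesRegularity.FluidComputer
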